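import Summits.Ventures.HodgeRepro.CMType

/-!
# The number of CM types of `(G, c)` is `2^(|G|/2)` (seat `p1`, gen 4)

Blind re-derivation cell `pub-hodge-repro`.  On the `typer` vocabulary (`IsComplexConj`, `IsCMType`, `cmTypes`):

* `exists_isCMType` — every finite group with complex conjugation has a CM type (pick, in each conjugate pair
  `{x, c x}`, the element that comes first under an enumeration of `G`);
* `typeOfChoice c Φ₀ T` — given a CM type `Φ₀` and `T ⊆ Φ₀`, the CM type that agrees with `Φ₀` on `T` and takes the
  conjugate choice on `Φ₀ ∖ T`;
* `card_cmTypes_eq_two_pow` / **`card_cmTypes`** — `Φ ↦ Φ ∩ Φ₀` is a bijection from the CM types onto the subsets of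
  `Φ₀`, so there are `2^|Φ₀| = 2^(|G|/2)` CM types (`[F : ℚ] = 2m` places give `2^m` CM types).

Used by the twist-class count of `proofs/P1.md` §8 (Lemma 1: `#squares = C(m,2)·2^(m−2)`); the sealed census's
`8, 16, 64` CM types at orders `6, 8, 12` are the instances `2^3, 2^4, 2^6`.
-/

open Finset

namespace HodgeRepro

variable {G : Type*} [Group G] [DecidableEq G] [Fintype G]

omit [DecidableEq G] in
/-- Every `(G, c)` has a CM type: in each pair `{x, c x}` take the element enumerated first. -/
theorem exists_isCMType {c : G} (hc : IsComplexConj c) : ∃ Φ : Finset G, IsCMType c Φ := by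
  let e := Fintype.equivFin G
  refine ⟨univ.filter fun x => e x < e (c * x), fun x => ?_⟩
  simp only [mem_filter, mem_univ, true_and, hc.mul_mul_cancel]
  have hne : e x ≠ e (c * x) := fun h => hc.mul_ne_self x (e.injective h).symm
  constructor
  · intro h1 h2; exact absurd (h1.trans h2) (lt_irrefl _)
  · intro h
    rcases lt_or_gt_of_ne hne with h' | h'
    · exact h'
    · exact absurd h' h

/-- The CM type with the choices `T ⊆ Φ₀`: `T` together with the conjugates of `Φ₀ ∖ T`. -/
def typeOfChoice (c : G) (Φ₀ T : Finset G) : Finset G := T ∪ (Φ₀ \ T).image fun y => c * y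

omit [Fintype G] in
/-- Membership in `typeOfChoice`: `x ∈ T`, or `c x ∈ Φ₀ ∖ T`. -/
theorem mem_typeOfChoice {c : G} (hc : IsComplexConj c) {Φ₀ T : Finset G} {x : G} :
    x ∈ typeOfChoice c Φ₀ T ↔ x ∈ T ∨ (c * x ∈ Φ₀ ∧ c * x ∉ T) := by
  simp only [typeOfChoice, mem_union, mem_image, mem_sdiff]
  constructor
  · rintro (h | ⟨y, ⟨hy1, hy2⟩, rfl⟩)
    · exact Or.inl h
    · right; rw [hc.mul_mul_cancel]; exact ⟨hy1, hy2⟩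
  · rintro (h | ⟨h1, h2⟩)
    · exact Or.inl h
    · exact Or.inr ⟨c * x, ⟨h1, h2⟩, hc.mul_mul_cancel x⟩

omit [Fintype G] in
/-- `typeOfChoice c Φ₀ T` is a CM type whenever `Φ₀` is one and `T ⊆ Φ₀`. -/
theorem isCMType_typeOfChoice {c : G} (hc : IsComplexConj c) {Φ₀ T : Finset G} (hΦ₀ : IsCMType c Φ₀)
    (hT : T ⊆ Φ₀) : IsCMType c (typeOfChoice c Φ₀ T) := by
  intro x
  rw [mem_typeOfChoice hc, mem_typeOfChoice hc, hc.mul_mul_cancel]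
  have h0 := hΦ₀ x
  by_cases hx : x ∈ Φ₀
  · have hcx : c * x ∉ Φ₀ := h0.1 hx
    constructor
    · rintro (h | ⟨h, -⟩)
      · rintro (h' | ⟨-, h'⟩)
        · exact hcx (hT h')
        · exact h' h
      · exact absurd h hcx
    · intro h
      left
      by_contra h'
      exact h (Or.inr ⟨hx, h'⟩)
  · have hcx : c * x ∈ Φ₀ := by
      by_contra h'
      exact hx (h0.2 h')
    constructor
    · rintro (h | ⟨-, h⟩)
      · exact absurd (hT h) hx
      · rintro (h' | ⟨h', -⟩)
        · exact h h'
        · exact hx h'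
    · intro h
      exact Or.inr ⟨hcx, fun h' => h (Or.inl h')⟩

/-- The CM types of `(G, c)` are in bijection with the subsets of any fixed CM type `Φ₀`, via `Φ ↦ Φ ∩ Φ₀`. -/
theorem card_cmTypes_eq_two_pow {c : G} (hc : IsComplexConj c) {Φ₀ : Finset G} (hΦ₀ : IsCMType c Φ₀) :
    (cmTypes c).card = 2 ^ Φ₀.card := by
  rw [← card_powerset]
  refine card_bij' (fun Φ _ => Φ ∩ Φ₀) (fun T _ => typeOfChoice c Φ₀ T) ?_ ?_ ?_ ?_
  · intro Φ _
    exact mem_powerset.2 inter_subset_right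
  · intro T hT
    exact mem_cmTypes.2 (isCMType_typeOfChoice hc hΦ₀ (mem_powerset.1 hT))
  · intro Φ hΦ
    have hΦ' := mem_cmTypes.1 hΦ
    ext x
    rw [mem_typeOfChoice hc, mem_inter, mem_inter]
    have h0 := hΦ₀ x
    have h1 := hΦ' x
    by_cases hx : x ∈ Φ₀
    · have hcx : c * x ∉ Φ₀ := h0.1 hx
      constructor
      · rintro (⟨h, -⟩ | ⟨h, -⟩)
        · exact h
        · exact absurd h hcx
      · intro h; exact Or.inl ⟨h, hx⟩
    · have hcx : c * x ∈ Φ₀ := by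
        by_contra h'
        exact hx (h0.2 h')
      constructor
      · rintro (⟨-, h⟩ | ⟨-, h⟩)
        · exact absurd h hx
        · exact h1.2 fun hc' => h ⟨hc', hcx⟩
      · intro h
        right
        exact ⟨hcx, fun h' => h1.1 h h'.1⟩
  · intro T hT
    have hT' := mem_powerset.1 hT
    ext x
    rw [mem_inter, mem_typeOfChoice hc]
    have h0 := hΦ₀ x
    constructor
    · rintro ⟨h | ⟨h, -⟩, hx⟩
      · exact h
      · exact absurd h (h0.1 hx)
    · intro h
      exact ⟨Or.inl h, hT' h⟩

/-- **The number of CM types** of `(G, c)` is `2^(|G|/2)`. -/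
theorem card_cmTypes {c : G} (hc : IsComplexConj c) : (cmTypes c).card = 2 ^ (Fintype.card G / 2) := by
  obtain ⟨Φ₀, hΦ₀⟩ := exists_isCMType hc
  rw [card_cmTypes_eq_two_pow hc hΦ₀]
  have := hΦ₀.two_mul_card hc
  congr 1
  omega

end HodgeRepro
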